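import Summits.BirchSwinnertonDyer.Rank1Residual.Partition.CornersMultTargetA
import Summits.BirchSwinnertonDyer.Rank1Residual.X2.ClassClosureOfDatum
import HarnessLib

/-!
# The MULTIPLICATIVE axis after the X2a closure — the DATUM forms: the §C corner predicates of
# `Partition/CornersMultTargetA` with the X2a closure term RE-THREADED through the Greenberg–Vatsal
# §2 datum records (cell `b2b-bsdres`, RESIDUAL-MAP.md §C row 'X2' / §I N9; rmap-1 gen 10, after
# eisenstein-p2 gen 26's `X2/ClassClosureOfDatum`, p297066)

HONEST FRAMING (run/shared/lean/b2b/bsd-rank1-residual/, verbatim in every file): the goal of the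
cell is to DELETE the COMBINATION-SHAPED residual classes of the Birch–Swinnerton-Dyer formula for
ALL analytic-rank `≤ 1` elliptic curves over `ℚ` — "full BSD formula for every rank `≤ 1` curve in
class `C`" assembled STRICTLY from published theorems — so that the rank-`≤ 1` remainder becomes
exactly the CONSTRUCTION-SHAPED classes, which are TYPED (missing-input `Prop`s), NOT attempted.
This is not "finishing BSD". Theorems only; NO definition, NO named fact introduced here; every
published theorem enters as one of the tree's existing named Literature facts BY NAME; nothing
about any particular curve is asserted; no label changes; nothing is booked by this file.

## What this file records

`Partition/CornersMultTargetA.lean` (rmap-1 gen 9) states the §C corner predicate after referee A's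
booking of the X2a sub-cell (R199.2 / R201.2): at an odd multiplicative `p`, in analytic rank `0`,
`BSD(E,p)` unless X11a or X2b; in rank `≤ 1` modulo the pair's Schneider certificate, unless X11a, or
X2 outside its two GV-parity sub-cells, or X11b off the `p`-adic lever's locus — with the X2a
closure `X2.TargetA` fed by eisenstein-p2's registered-facts terms (`targetA_of_derivedFacts`,
twenty binders; `targetA_of_derivedF0_heightFree`, seventeen binders, A223 a theorem).

Eisenstein-p2 gen 26 (`X2/ClassClosureOfDatum`, p297066) RE-THREADED the X2a term: the curve-level
Greenberg–Vatsal (5)–(7) binder at a multiplicative prime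
`hΛ : lambda_nonPrimitive_eq_add_sum_delta_multiplicative` (registry A133) is now DERIVED on the tree
(`X2.NonPrimitiveLambdaInvariantMultiplicativeDerived.lambda_nonPrimitive_eq_add_sum_delta_multiplicative_of_datum`)
from its printed sources — `h23 : datumSelmer_nonPrimitive_invariants` (GV §2 Prop. (2.1) /
Cor. (2.3) / Prop. (2.4) for the Greenberg datum, registry T-GV23L), the Tate uniformisations
`hT` / `hT'` (A40 / A41, already binders) and `hInf : datumStrictSelmer_relIndex_eq_zero_of_split`
(the trivial-zero infinite index at a split prime, GV p. 15 with p. 20, registry A137′). This file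
lifts the re-threaded term to the Partition level, nothing else:

* `bsdp_mult_rankZero_of_datum` — **odd multiplicative `p`, `r = 0`: `BSD(E,p)` unless X11a or
  X2b, from NINETEEN named facts** (Skinner 2016 Thm. C + the eighteen binders of
  `X2.ClassClosureOfDatum.targetA_of_datum_heightFree`); partition form
  `bsdp_or_corner_mult_rankZero_of_datum`;
* `bsdp_mult_of_schneider_sharp_of_datum` — **odd multiplicative `p`, `r ≤ 1`, modulo the pair's
  Schneider certificate: `BSD(E,p)` unless X11a, or X2 outside both GV-parity sub-cells, or X11b off
  the lever's locus, from TWENTY-THREE named facts + the two certificate binders** (versus gen 9's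
  `bsdp_mult_of_schneider_sharp_of_derivedFacts`: `hEx` A223 and `hΛ` A133 gone, `h23` T-GV23L and
  `hInf` A137′ in; the rank-`1` lever keeps the Stein–Wuthrich §4.2 height-existence binders);
  partition form `bsdp_or_corner_mult_of_schneider_of_datum`.

Same conclusions as the gen-9 forms, one binder more in rank `0`, every binder a registered record
closer to the printed page. Bookkeeping only; which binder set is "of record" is the registry's /
the referee's call (b2b REFEREE.md), not this file's.

References: C. Skinner, Pacific J. Math. 283 (2016) Thm. A, Thm. C; R. Greenberg, V. Vatsal, Invent.
Math. 142 (2000) Thm. (1.3), §2 Prop. (2.1), Cor. (2.3), Prop. (2.4), pp. 14–15, 20, §3 Thm. (3.11);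
R. Greenberg, LNM 1716 (1999) Prop. 5.10; C. Wuthrich, Doc. Math. 19 (2014) Thm. 16; W. Stein,
C. Wuthrich, Math. Comp. 82 (2013) Thm. 6.1, §4.2; D. Disegni, Kyoto J. Math. 60 (2020) Thm. 1;
J. Silverman, GTM 151 (1994) Ch. V Thm. 5.3, Cor. 5.4; referee A `pub/pub-bsdpct/REFEREE.md`
ROUND 199 R199.2, ROUND 201 R201.2.
-/

namespace Summit.BirchSwinnertonDyer.Rank1Residual

open WeierstrassCurve Literature.NumberTheory.EllipticCurves
  Literature.NumberTheory.EllipticCurves.Rank1Residual Literature.NumberTheory.EllipticCurves.ModularForms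
  Literature.NumberTheory.EllipticCurves.Wuthrich2014
  Literature.NumberTheory.EllipticCurves.GreenbergVatsal2000
  Literature.NumberTheory.EllipticCurves.Rank1Residual.Typed
  Literature.NumberTheory.EllipticCurves.Skinner2016
  Literature.NumberTheory.EllipticCurves.SteinWuthrich2013
  Literature.NumberTheory.EllipticCurves.Disegni2020
open scoped NumberField ModularForm

section Curve

variable {W : WeierstrassCurve ℚ} [W.IsElliptic] [W.IsGloballyMinimal] {p : ℕ} [Fact p.Prime]

/-! ### Rank `0`: the corner is X11a ∨ X2b — nineteen named facts -/

/-- **Multiplicative axis, rank `0`, odd `p`, after the X2a closure — the DATUM form: NINETEEN named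
facts, no typed input, no certificate.** `bsdp_mult_rankZero_of_targetA` with `X2.TargetA` supplied
by eisenstein-p2's `X2.ClassClosureOfDatum.targetA_of_datum_heightFree` (A133 replaced by T-GV23L +
A137′; A223 a theorem; no §4.2 height datum in rank `0`). `BSD(E,p)` unless `X11a ∨ X2b`.
[cite: Skinner2016PacificMC, Thm. C]
[cite: GreenbergVatsal2000, Thm. (1.3); §2 Prop. (2.1), Cor. (2.3), Prop. (2.4), pp. 14–15, 20; §3 Thm. (3.11)]
[cite: Wuthrich2014, Thm. 16 (p. 397)] -/
theorem bsdp_mult_rankZero_of_datum (hSk : Skinner2016.thmC_padicValRat_bsd_rank_zero)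
    (h23 : datumSelmer_nonPrimitive_invariants)
    (hInf : datumStrictSelmer_relIndex_eq_zero_of_split)
    (hT : Silverman1994_thmV53_tateUniformisation.{0})
    (hT' : Silverman1994_thmV53_corV54_tateUniformisation.{0})
    (hB : datumSelmer_divisible_of_finite_torsionBy)
    (hF : datumStrictSelmer_lt_datumSelmer_of_split)
    (hLiftF : residualEpsilon_surjOn_of_lineRamifiedEven)
    (hP : cor38_realPeriodRat_eq_unit_mul_of_isIsogenous_of_gvPar)
    (h311 : thm311_hasUnitContent_iff_and_order_eq_of_lineRamifiedEven)
    (hLC : characterLFunctionC_hasUnitContent_and_order_eq_card)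
    (hLD : characterLFunctionD_hasUnitContent_and_order_eq_card)
    (hWu : thm16_charIdeal_dvd_multiplicative_of_reducible)
    (hJs : thm61_splitMultiplicative) (hJn : thm61_nonsplitMultiplicative)
    (hGZK : rank_eq_analyticRank_of_analyticRank_le_one) (hmod : hasEntireLFunction_rat)
    (hpar : nonempty_modularParametrizationData)
    (hGS : ∀ (W : WeierstrassCurve ℚ) [W.IsElliptic] [W.IsGloballyMinimal] (p : ℕ) [Fact p.Prime],
      greenberg_stevens (W := W) (p := p))
    (hp : p ≠ 2) (hm : Mult W p) (hr0 : W.analyticRank = 0)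
    (hX11a : ¬ ClassX11a W p) (hX2b : ¬ (ClassX2 W p ∧ ¬ GVPar W p)) : BSDp W p :=
  bsdp_mult_rankZero_of_targetA hSk hmod hGZK
    (X2.ClassClosureOfDatum.targetA_of_datum_heightFree h23 hInf hT hT' hB hF hLiftF hP h311 hLC hLD
      hWu hJs hJn hGZK hmod hpar hGS)
    hp hm hr0 hX11a hX2b

/-- **Partition form, multiplicative axis, rank `0`, the datum form (nineteen named facts):
`BSD(E,p) ∨ X11a ∨ X2b`.** [folklore] -/
theorem bsdp_or_corner_mult_rankZero_of_datum (hSk : Skinner2016.thmC_padicValRat_bsd_rank_zero)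
    (h23 : datumSelmer_nonPrimitive_invariants)
    (hInf : datumStrictSelmer_relIndex_eq_zero_of_split)
    (hT : Silverman1994_thmV53_tateUniformisation.{0})
    (hT' : Silverman1994_thmV53_corV54_tateUniformisation.{0})
    (hB : datumSelmer_divisible_of_finite_torsionBy)
    (hF : datumStrictSelmer_lt_datumSelmer_of_split)
    (hLiftF : residualEpsilon_surjOn_of_lineRamifiedEven)
    (hP : cor38_realPeriodRat_eq_unit_mul_of_isIsogenous_of_gvPar)
    (h311 : thm311_hasUnitContent_iff_and_order_eq_of_lineRamifiedEven)
    (hLC : characterLFunctionC_hasUnitContent_and_order_eq_card)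
    (hLD : characterLFunctionD_hasUnitContent_and_order_eq_card)
    (hWu : thm16_charIdeal_dvd_multiplicative_of_reducible)
    (hJs : thm61_splitMultiplicative) (hJn : thm61_nonsplitMultiplicative)
    (hGZK : rank_eq_analyticRank_of_analyticRank_le_one) (hmod : hasEntireLFunction_rat)
    (hpar : nonempty_modularParametrizationData)
    (hGS : ∀ (W : WeierstrassCurve ℚ) [W.IsElliptic] [W.IsGloballyMinimal] (p : ℕ) [Fact p.Prime],
      greenberg_stevens (W := W) (p := p))
    (hp : p ≠ 2) (hm : Mult W p) (hr0 : W.analyticRank = 0) :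
    BSDp W p ∨ ClassX11a W p ∨ (ClassX2 W p ∧ ¬ GVPar W p) := by
  by_cases hX11a : ClassX11a W p
  · exact Or.inr (Or.inl hX11a)
  by_cases hX2b : ClassX2 W p ∧ ¬ GVPar W p
  · exact Or.inr (Or.inr hX2b)
  exact Or.inl (bsdp_mult_rankZero_of_datum hSk h23 hInf hT hT' hB hF hLiftF hP h311 hLC hLD hWu hJs
    hJn hGZK hmod hpar hGS hp hm hr0 hX11a hX2b)

/-! ### Rank `≤ 1` modulo the Schneider certificate — twenty-three named facts + two binders -/

/-- **SHARP MODULO THE SCHNEIDER CERTIFICATE, multiplicative axis, rank `≤ 1`, the DATUM form: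
TWENTY-THREE named facts + the two certificate binders.** `bsdp_mult_of_schneider_sharp_targetA`
with BOTH discharged inputs re-threaded through the datum records: the Greenberg–Vatsal
multiplicative clause `lambdaMu_multiplicative_of_gvPar` by eisenstein-p2's
`X2.ClassClosureOfDerivedF0.lambdaMu_multiplicative_of_gvPar_of_derivedF0` fed with the DERIVED
A133 term `lambda_nonPrimitive_eq_add_sum_delta_multiplicative_of_datum h23 hT hT' hInf` (A223 a
theorem inside), and `X2.TargetA` by `X2.ClassClosureOfDatum.targetA_of_datum_heightFree`. Versus
`bsdp_mult_of_schneider_sharp_of_derivedFacts`: `hEx` (A223) and `hΛ` (A133) gone, `h23` (T-GV23L)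
and `hInf` (A137′) in; the rank-`1` lever keeps the Stein–Wuthrich §4.2 height-existence binders
`hHs` / `hHn`. `BSD(E,p)` at an odd multiplicative `p` in analytic rank `≤ 1`, modulo the pair's
Schneider certificate, unless X11a, or X2 outside its two GV-parity sub-cells, or X11b off the
lever's locus. [cite: Skinner2016PacificMC, Thm. A, Thm. C]
[cite: GreenbergVatsal2000, Thm. (1.3); §2 Prop. (2.1), Cor. (2.3), Prop. (2.4); §3 Thm. (3.11), (28)]
[cite: Wuthrich2014, Thm. 16 (p. 397)] [cite: SteinWuthrich2013, Thm. 6.1 (p. 20), §4.2]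
[cite: Disegni2020, Thm. 1] -/
theorem bsdp_mult_of_schneider_sharp_of_datum
    (hSk : Skinner2016.thmC_padicValRat_bsd_rank_zero) (hA : thmA_charIdeal_multiplicative)
    (hD : thm1_padicBSD_rankOne_multiplicative)
    (h23 : datumSelmer_nonPrimitive_invariants)
    (hInf : datumStrictSelmer_relIndex_eq_zero_of_split)
    (hT : Silverman1994_thmV53_tateUniformisation.{0})
    (hT' : Silverman1994_thmV53_corV54_tateUniformisation.{0})
    (hB : datumSelmer_divisible_of_finite_torsionBy)
    (hF : datumStrictSelmer_lt_datumSelmer_of_split)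
    (hLiftF : residualEpsilon_surjOn_of_lineRamifiedEven)
    (hP : cor38_realPeriodRat_eq_unit_mul_of_isIsogenous_of_gvPar)
    (h311 : thm311_hasUnitContent_iff_and_order_eq_of_lineRamifiedEven)
    (hLC : characterLFunctionC_hasUnitContent_and_order_eq_card)
    (hLD : characterLFunctionD_hasUnitContent_and_order_eq_card)
    (hWu : thm16_charIdeal_dvd_multiplicative_of_reducible)
    (hJs : thm61_splitMultiplicative) (hJn : thm61_nonsplitMultiplicative)
    (hHs : exists_isSplitMultCanonical) (hHn : exists_isMultCanonical)
    (hGZK : rank_eq_analyticRank_of_analyticRank_le_one) (hmod : hasEntireLFunction_rat)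
    (hpar : nonempty_modularParametrizationData)
    (hGS : ∀ (W : WeierstrassCurve ℚ) [W.IsElliptic] [W.IsGloballyMinimal] (p : ℕ) [Fact p.Prime],
      greenberg_stevens (W := W) (p := p))
    (hp : p ≠ 2) (hm : Mult W p) (hr : W.analyticRank ≤ 1)
    (hSchN : ∀ (q : ℚ_[p]) (Dh : PAdicHeightData W p), q ≠ 0 → ‖q‖ < 1 → tateJ q = (W.j : ℚ_[p]) →
      IsMultCanonical Dh q → SchneiderConjecture Dh)
    (hSchS : ∀ (Dq : TateParameterData W p) (Dh : PAdicHeightData W p),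
      IsSplitMultCanonical Dh Dq → SchneiderConjecture Dh)
    (hX11a : ¬ ClassX11a W p)
    (hX2 : ¬ (ClassX2 W p ∧ ¬ (W.analyticRank = 0 ∧ GVPar W p) ∧
      ¬ (W.analyticRank = 1 ∧ ¬ W.HasSplitMultiplicativeReductionAtPrime p ∧ GVPar W p)))
    (hlev : ¬ (ClassX11b W p ∧ ¬ (Ram W p ∧ (W.HasSplitMultiplicativeReductionAtPrime p → 5 ≤ p)))) :
    BSDp W p :=
  bsdp_mult_of_schneider_sharp_targetA hSk hmod hGZK hA hJn hJs hHn hHs hD hpar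
    (X2.ClassClosureOfDerivedF0.lambdaMu_multiplicative_of_gvPar_of_derivedF0 hT hT'
      (X2.NonPrimitiveLambdaInvariantMultiplicativeDerived.lambda_nonPrimitive_eq_add_sum_delta_multiplicative_of_datum
        h23 hT hT' hInf)
      hB hF hLiftF hP h311 hLC hLD hWu)
    hWu
    (X2.ClassClosureOfDatum.targetA_of_datum_heightFree h23 hInf hT hT' hB hF hLiftF hP h311 hLC hLD
      hWu hJs hJn hGZK hmod hpar hGS)
    hp hm hr hSchN hSchS hX11a hX2 hlev

/-- **Partition form on the multiplicative axis, rank `≤ 1`, modulo the certificate, the datum form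
(twenty-three named facts + two binders): `BSD(E,p) ∨ X11a ∨ (X2 ∧ ¬(r = 0 ∧ gvpar) ∧
¬(r = 1 ∧ ¬split ∧ gvpar)) ∨ (X11b off the lever's locus)`.** [folklore] -/
theorem bsdp_or_corner_mult_of_schneider_of_datum
    (hSk : Skinner2016.thmC_padicValRat_bsd_rank_zero) (hA : thmA_charIdeal_multiplicative)
    (hD : thm1_padicBSD_rankOne_multiplicative)
    (h23 : datumSelmer_nonPrimitive_invariants)
    (hInf : datumStrictSelmer_relIndex_eq_zero_of_split)
    (hT : Silverman1994_thmV53_tateUniformisation.{0})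
    (hT' : Silverman1994_thmV53_corV54_tateUniformisation.{0})
    (hB : datumSelmer_divisible_of_finite_torsionBy)
    (hF : datumStrictSelmer_lt_datumSelmer_of_split)
    (hLiftF : residualEpsilon_surjOn_of_lineRamifiedEven)
    (hP : cor38_realPeriodRat_eq_unit_mul_of_isIsogenous_of_gvPar)
    (h311 : thm311_hasUnitContent_iff_and_order_eq_of_lineRamifiedEven)
    (hLC : characterLFunctionC_hasUnitContent_and_order_eq_card)
    (hLD : characterLFunctionD_hasUnitContent_and_order_eq_card)
    (hWu : thm16_charIdeal_dvd_multiplicative_of_reducible)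
    (hJs : thm61_splitMultiplicative) (hJn : thm61_nonsplitMultiplicative)
    (hHs : exists_isSplitMultCanonical) (hHn : exists_isMultCanonical)
    (hGZK : rank_eq_analyticRank_of_analyticRank_le_one) (hmod : hasEntireLFunction_rat)
    (hpar : nonempty_modularParametrizationData)
    (hGS : ∀ (W : WeierstrassCurve ℚ) [W.IsElliptic] [W.IsGloballyMinimal] (p : ℕ) [Fact p.Prime],
      greenberg_stevens (W := W) (p := p))
    (hp : p ≠ 2) (hm : Mult W p) (hr : W.analyticRank ≤ 1)
    (hSchN : ∀ (q : ℚ_[p]) (Dh : PAdicHeightData W p), q ≠ 0 → ‖q‖ < 1 → tateJ q = (W.j : ℚ_[p]) →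
      IsMultCanonical Dh q → SchneiderConjecture Dh)
    (hSchS : ∀ (Dq : TateParameterData W p) (Dh : PAdicHeightData W p),
      IsSplitMultCanonical Dh Dq → SchneiderConjecture Dh) :
    BSDp W p ∨ ClassX11a W p ∨
      (ClassX2 W p ∧ ¬ (W.analyticRank = 0 ∧ GVPar W p) ∧
        ¬ (W.analyticRank = 1 ∧ ¬ W.HasSplitMultiplicativeReductionAtPrime p ∧ GVPar W p)) ∨
      (ClassX11b W p ∧ ¬ (Ram W p ∧ (W.HasSplitMultiplicativeReductionAtPrime p → 5 ≤ p))) := by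
  by_cases hX11a : ClassX11a W p
  · exact Or.inr (Or.inl hX11a)
  by_cases hX2 : ClassX2 W p ∧ ¬ (W.analyticRank = 0 ∧ GVPar W p) ∧
      ¬ (W.analyticRank = 1 ∧ ¬ W.HasSplitMultiplicativeReductionAtPrime p ∧ GVPar W p)
  · exact Or.inr (Or.inr (Or.inl hX2))
  by_cases hlev : ClassX11b W p ∧ ¬ (Ram W p ∧ (W.HasSplitMultiplicativeReductionAtPrime p → 5 ≤ p))
  · exact Or.inr (Or.inr (Or.inr hlev))
  exact Or.inl (bsdp_mult_of_schneider_sharp_of_datum hSk hA hD h23 hInf hT hT' hB hF hLiftF hP h311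
    hLC hLD hWu hJs hJn hHs hHn hGZK hmod hpar hGS hp hm hr hSchN hSchS hX11a hX2 hlev)

end Curve

end Summit.BirchSwinnertonDyer.Rank1Residual
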